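/-
Copyright (c) 2026 the pub-hodgecm-mathlib formalisation cell (harness21).  Prover seat hodgecm-mathlib-F0P3a-p01 (g34), req620 Track A «(D-RAM) FOUR-FRAME» squad, unit U2H:
the (ρ2b′-X) child (U2H ED. 15 :418) — SOCKET (C) (type RamM) organ (C-5b) Σ3a «THE FAR-CELL CLASS CRITERION AND THE S9 FACTORISATION OF THE TWIST» ((C) lead LH4-p04 (g5)
LINE #15 «Σ3»).  2026-09-04.
-/
import Summits.HodgeConjecture.HodgeConjecture.Theorems.F0P3cDyRamToricLevelCensusRamMTopCellsPrep   -- ★ (LH4-p06): brings ★ Side (`anchored_twist_near_iff_lt_threshold`), `v_mul_sub_one_le_iff_of_near_one`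
import Summits.HodgeConjecture.HodgeConjecture.Theorems.F0P3cDyRamClassLettersRamM                   -- ★ p858341 (this seat): ψ-calculus (`v_map_div_sub_one_eq_of_odd`, `div_mul_div_eq_map_mul_div`)
import Summits.HodgeConjecture.HodgeConjecture.Theorems.F0P3cDyRamSideNormCriterionRamM               -- ★ p858275 (this seat): Σ1 `side_iff_exists_norm_ramM`
import Summits.HodgeConjecture.HodgeConjecture.Theorems.F0P3cDyRamTokenSignRamK                        -- ★ p857819 (LH4-p13): `rho_map_signKappa` (type-free S9 algebra)
import Literature.NumberTheory.LocalFields.WildQuadraticDatumNormSignConductor                         -- ★ `exists_nonnorm_dichotomy` (K♮ˣ = N ⊔ c₀N)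
import HarnessLib

/-!
# Crux `H413`, line LH4 «(D-RAM) FOUR-FRAME» road — unit U2H, (ρ2b′-X), SOCKET (C): THE FAR-CELL CLASS CRITERION AND THE S9 FACTORISATION OF THE TWIST (Σ3a of the RamM sign law)

Cell `hodgecm-mathlib` (D-0151), FLOOR 0, crux item H413 = `stmt-HodgeConjecture-24833`, route of record `HCCMUnconditional`; squad F0∕P3c∕LH4; registered stub served:
`F0P3cDyRamFourFrameU2H.stub_U2H_fixedPointCensus_typeTwo_unit0` ((ρ2b′-X), U2H ED. 15 :418) through the typed bottom socket (C) `SOCKET-hOCC.v1` (869d0c15; type RamM).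
The (C-5b) sign law must decide, at the reference far cell `c″ = s0 + 2g − 1` (radius `R″ = exp(−(2c″ + d_ρ)) = |jK π′|^{d′ + (dΘ − 1)}`, one notch below the threshold of
★ LH4-p06 `anchored_twist_near_iff_lt_threshold`), WHICH CLASS (T = norm class, E = anchored class) the twist `κ_tw = ρμ∕μ` (`μ = λ − u`) belongs to.  THIS FILE (one field
`K` = `M`) reduces that to the norm question of Σ1 ★ p858275 on ONE Θ-fixed element, the S9 element `κ_S9` of ★ p857819:
* §1 (algebra) **`ρμ∕μ = ψ(κ_S9)·ρλ′`** EXACTLY (`ψ(c) = ρc∕c`, `κ_S9 = (λ′ − u′)(1 + λ′)(1 + u′)∕(ω λ′ u′)`, `λ′ = λ∕ν`, `u′ = u∕ν`, `λ′ρλ′ = 1`; ★ `rho_map_signKappa`), and the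
  twist is insensitive to the ρ-fixed normaliser `ν`;
* §2 (near-one transfer) a unit factor `l` with `|l − 1| ≤ R` does not change class-T∕class-E membership at radius `R` (★ p06 `v_mul_sub_one_le_iff_of_near_one`);
* §3 THE FAR-CELL CLASS CRITERION for a Θ-fixed `y ≠ 0` at `R″`: CLASS T (`∃ ω ∈ U_M, |ψ(y)·t(ω) − 1| ≤ R″`) ⇒ **`y ∈ F^×·N_Θ(U_M)`** (`exists_fixed_mul_norm_of_twistNear_far`:
  the odd shell `|ψ − 1| = exp(−(2d′ − 2))` of ★ p858341 lies outside `R″`, so `ord_M y ∈ 4ℤ`; unitise by the doubly fixed `Q = N_Θ(ϖρϖ)`, `ϖ := jKπ′∕…` — here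
  `Q := (P·ρP)`-free: `Q := (jKπ′·ρ(jKπ′))` — and run ★ `exists_nonnorm_dichotomy` against the threshold); CLASS E ⇒ `y ∈ F^×·n₀·N_Θ(U_M)`; hence
  **class T ⇒ `∃ e, ρe = e ∧ e·Θe = y·ρy`** (`exists_rhoNorm_of_twistNear_far`) and **class E ⇒ `¬ ∃ e, …`** (`not_exists_rhoNorm_of_anchoredNear_far`, via Σ1 and
  `F^× ⊆ N_Θ(M^×)`: ★ hFN on units, `Q = N_Θ(ϖM·ρϖM)` on the value group);
* §4 the radius dictionary `|jK π′^{d′ + (dΘ − 1)}| = exp(−(2(s0 + 2g − 1) + d_ρ))` (`dΘ = 2g`, `2d′ = d_ρ + 2s0`).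
Σ3b (CM: `(β, θ)_v = 1 ⟺ ∃ e, ρe = e ∧ e·Θe = κ_S9·ρκ_S9`) and Σ3c (assembly in ★ p06's wrapper letters) follow.  THEOREMS ONLY (no `def`, no instance, no notation, no `sorry`);
lane `--supports stmt-HodgeConjecture-24833 --as helper` (count-neutral).
(R-26) inhabitant: ℚ₂(ζ₈) ⊃ ℚ₂(i) (the (C) frame of HEAD.C v2; `d′ = 3`, `dΘ = 2`, `R″ = exp(−8 − d_ρ)`).
HONEST LABEL.  Count-neutral helper; (ρ2b′-X) stays an OPEN prover target; `HC_CM` is proved only modulo the 7 printed citations (2 remaining named inputs: hLiu418 =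
`stmt-HodgeConjecture-24832`, h413 = `stmt-HodgeConjecture-24833`) until rung 0 closes.

## References
* [Serre1979] J.-P. Serre, *Local Fields*, GTM 67 (1979), Ch. V §3 Prop. 5 and Cor. 3 (norm residue classes of a ramified quadratic extension), Ch. X §1 (Hilbert 90).
* [Rogawski1990] J. D. Rogawski, *Automorphic Representations of Unitary Groups in Three Variables*, Ann. of Math. Stud. 123 (1990), §4.9 Prop. 4.9.1 (b) p. 55, Lemma 4.9.3 p. 56.
* [LabesseLanglands1979] J.-P. Labesse, R. P. Langlands, *L-indistinguishability for SL(2)*, Canad. J. Math. 31 (1979), §2 (2.1)–(2.2) pp. 7–8.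
* [Jacobowitz1962] R. Jacobowitz, *Hermitian forms over local fields*, Amer. J. Math. 84 (1962), §4.
-/

set_option autoImplicit false

noncomputable section

open WithZero
open Literature.NumberTheory.Automorphic.UnitaryThreeFourFrame (IsRamifiedQuadraticDatum)
open Literature.NumberTheory.LocalFields.WildQuadraticDatum (exists_nonnorm_dichotomy v_eq_one_of_v_mul_map_eq_one)
open Summit.HodgeConjecture.HodgeConjecture.Cruxes.H413.F0P3cDyRamToricLevelCensusRamM (anchored_twist_near_iff_lt_threshold v_mul_sub_one_le_iff_of_near_one)
open Summit.HodgeConjecture.HodgeConjecture.Cruxes.H413.F0P3cDyRamClassLettersRamM (div_mul_div_eq_map_mul_div v_map_div_sub_one_eq_of_odd)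
open Summit.HodgeConjecture.HodgeConjecture.Cruxes.H413.F0P3cDyRamSideNormCriterionRamM (side_iff_exists_norm_ramM)
open Summit.HodgeConjecture.HodgeConjecture.Cruxes.H413.F0P3cDyRamTokenSignRamK (rho_map_signKappa)
open scoped Valued

namespace Summit.HodgeConjecture.HodgeConjecture.Cruxes.H413.F0P3cDyRamSignFarCellRamM

variable {K : Type} [Field K] [Valued K ℤᵐ⁰] {ρ Θ : K →+* K}
variable {K' : Type*} [Field K'] [Valued K' ℤᵐ⁰] {σ' : K' →+* K'} {π' : K'} {d' : ℕ}

/-! ## §1 The S9 factorisation of the twist -/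

omit [Valued K ℤᵐ⁰] in
/-- **`ρμ′∕μ′ = ψ(κ_S9)·ρλ′`** with `μ′ = λ′ − u′`, `κ_S9 = (λ′ − u′)(1 + λ′)(1 + u′)∕(ω λ′ u′)`, `ψ(c) = ρc∕c`: for `λ′ρλ′ = 1`, `ρu′ = u′`, `u′Θu′ = 1`, `ρω = ω` (all the displayed
quantities non-zero).  EXACT — no approximation (`ρμ′ = (1 − λ′u′)∕λ′`, `ψ(κ_S9) = (1 − λ′u′)∕(λ′ − u′)` by ★ `rho_map_signKappa`). [cite: Rogawski1990, §4.9 Lemma 4.9.3 p. 56]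
[cite: LabesseLanglands1979, §2 (2.1)–(2.2) pp. 7–8] -/
theorem twist_eq_map_signKappa_div_mul {lam u ω : K} (hlamρ : lam * ρ lam = 1) (hu : ρ u = u) (hu1 : u * Θ u = 1) (hρω : ρ ω = ω)
    (hω0 : ω ≠ 0) (h1lam : 1 + lam ≠ 0) (h1u : 1 + u ≠ 0) (hne : lam - u ≠ 0) :
    ρ (lam - u) / (lam - u) =
      ρ ((lam - u) * (1 + lam) * (1 + u) / (ω * lam * u)) / ((lam - u) * (1 + lam) * (1 + u) / (ω * lam * u)) * ρ lam := by
  have hlam0 : lam ≠ 0 := fun h => by rw [h, zero_mul] at hlamρ; exact zero_ne_one hlamρ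
  have hu0 : u ≠ 0 := fun h => by rw [h, zero_mul] at hu1; exact zero_ne_one hu1
  have hρlam : ρ lam = lam⁻¹ := eq_inv_of_mul_eq_one_right hlamρ
  rw [rho_map_signKappa hlamρ hu hu1 hρω, map_sub, hu, hρlam]
  field_simp

omit [Valued K ℤᵐ⁰] in
/-- The twist is blind to a ρ-fixed normaliser: `ρ(λ − u)∕(λ − u) = ρ(λ∕ν − u∕ν)∕(λ∕ν − u∕ν)` for `ρν = ν ≠ 0`. [cite: Rogawski1990, §4.9 Lemma 4.9.3 p. 56] -/
theorem twist_eq_twist_div {lam u ν : K} (hρν : ρ ν = ν) (hν0 : ν ≠ 0) :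
    ρ (lam - u) / (lam - u) = ρ (lam / ν - u / ν) / (lam / ν - u / ν) := by
  rw [← sub_div, map_div₀, hρν, div_div_div_cancel_right₀ hν0]

omit [Valued K ℤᵐ⁰] in
/-- **THE OFF-PARITY UNIT `κ′ = −η∕κ_tw` IN S9 TERMS**: if `κ_tw = ψ(κ)·l⁻¹` (§1 with `l = λ′`, `ρλ′ = λ′⁻¹`) and `ρξ = −ξ`, then
`−(ρh∕h·ρN∕N)∕κ_tw = ψ(ξ·h·N∕κ)·l` — the class-T bit of ★ p858305 `bitLit_iff_twistNear_neg` is read on the Θ-fixed element `ξ·h·N∕κ`.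
[cite: Rogawski1990, §4.9 Lemma 4.9.3 p. 56] [cite: LabesseLanglands1979, §2 (2.1)–(2.2) pp. 7–8] -/
theorem neg_div_twist_eq_map_div_mul {h N κ l ξ κt : K} (hh : h ≠ 0) (hN : N ≠ 0) (hκ : κ ≠ 0) (hρκ : ρ κ ≠ 0) (hξ : ξ ≠ 0) (hl : l ≠ 0)
    (hρξ : ρ ξ = -ξ) (htw : κt = ρ κ / κ * l⁻¹) :
    -(ρ h / h * (ρ N / N)) / κt = ρ (ξ * h * N / κ) / (ξ * h * N / κ) * l := by
  subst htw
  rw [map_div₀, map_mul, map_mul, hρξ]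
  field_simp

/-! ## §2 Near-one transfer -/

/-- A unit factor `l` with `|l − 1| ≤ R` does not change class T at radius `R`. [cite: Serre1979, Ch. V §1] -/
theorem exists_twistNear_iff_of_near_factor {κ c l : K} (hfac : κ = c * l) (hl1 : Valued.v l = 1) {R : ℤᵐ⁰} (hl : Valued.v (l - 1) ≤ R) :
    (∃ ω : K, Valued.v ω = 1 ∧ Valued.v (κ * (ρ (ω * Θ ω) / (ω * Θ ω)) - 1) ≤ R) ↔
      ∃ ω : K, Valued.v ω = 1 ∧ Valued.v (c * (ρ (ω * Θ ω) / (ω * Θ ω)) - 1) ≤ R := by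
  have key : ∀ ω : K, Valued.v (κ * (ρ (ω * Θ ω) / (ω * Θ ω)) - 1) ≤ R ↔ Valued.v (c * (ρ (ω * Θ ω) / (ω * Θ ω)) - 1) ≤ R := fun ω => by
    rw [hfac, show c * l * (ρ (ω * Θ ω) / (ω * Θ ω)) = l * (c * (ρ (ω * Θ ω) / (ω * Θ ω))) by ring]
    exact v_mul_sub_one_le_iff_of_near_one hl hl1
  exact ⟨fun ⟨ω, hω, h⟩ => ⟨ω, hω, (key ω).1 h⟩, fun ⟨ω, hω, h⟩ => ⟨ω, hω, (key ω).2 h⟩⟩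

/-- A unit factor `l` with `|l − 1| ≤ R` does not change class E at radius `R`. [cite: Serre1979, Ch. V §1] -/
theorem exists_anchoredNear_iff_of_near_factor {κ c l n₀ : K} (hfac : κ = c * l) (hl1 : Valued.v l = 1) {R : ℤᵐ⁰} (hl : Valued.v (l - 1) ≤ R) :
    (∃ ω : K, Valued.v ω = 1 ∧ Valued.v (κ * (ρ n₀ / n₀) * (ρ (ω * Θ ω) / (ω * Θ ω)) - 1) ≤ R) ↔
      ∃ ω : K, Valued.v ω = 1 ∧ Valued.v (c * (ρ n₀ / n₀) * (ρ (ω * Θ ω) / (ω * Θ ω)) - 1) ≤ R := by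
  have key : ∀ ω : K, Valued.v (κ * (ρ n₀ / n₀) * (ρ (ω * Θ ω) / (ω * Θ ω)) - 1) ≤ R ↔
      Valued.v (c * (ρ n₀ / n₀) * (ρ (ω * Θ ω) / (ω * Θ ω)) - 1) ≤ R := fun ω => by
    rw [hfac, show c * l * (ρ n₀ / n₀) * (ρ (ω * Θ ω) / (ω * Θ ω)) = l * (c * (ρ n₀ / n₀) * (ρ (ω * Θ ω) / (ω * Θ ω))) by ring]
    exact v_mul_sub_one_le_iff_of_near_one hl hl1
  exact ⟨fun ⟨ω, hω, h⟩ => ⟨ω, hω, (key ω).1 h⟩, fun ⟨ω, hω, h⟩ => ⟨ω, hω, (key ω).2 h⟩⟩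

/-! ## §3 The far-cell class criterion -/

/-- The Θ-fixed ρ-ANTI-fixed element `ξ₁ := jKπ′ − ρ(jKπ′) = jK(π′ − σ′π′)` of the third-field package has valuation `exp(−2d′)`. [cite: Serre1979, Ch. IV §1 Prop. 3–4] -/
theorem v_thirdFieldUniformizer_sub_map (hdd' : Valued.v (π' - σ' π') = Valued.v π' ^ d')
    (jK : K' →+* K) (hjle : ∀ x y : K', Valued.v (jK x) ≤ Valued.v (jK y) ↔ Valued.v x ≤ Valued.v y)
    (hjσ : ∀ x, jK (σ' x) = ρ (jK x)) (hjπ : Valued.v (jK π') = exp (-2 : ℤ)) :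
    Valued.v (jK π' - ρ (jK π')) = exp (-(2 * (d' : ℤ))) := by
  have h1 : Valued.v (jK (π' - σ' π')) = Valued.v (jK (π' ^ d')) :=
    le_antisymm ((hjle _ _).2 (by rw [hdd', map_pow])) ((hjle _ _).2 (by rw [hdd', map_pow]))
  rw [← hjσ, ← map_sub, h1, map_pow, map_pow, hjπ, ← exp_nsmul, nsmul_eq_mul]
  congr 1; ring

/-- **A DOUBLY FIXED NON-ZERO `f` IS A Θ-NORM** (`F^× ⊆ N_Θ(M^×)`): `|f| ∈ exp(4ℤ)` (`hF4`), `Q := (ϖM·ρϖM)·Θ(ϖM·ρϖM) = N_Θ(ϖM·ρϖM)` is doubly fixed of valuation `exp(−4)`, and the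
doubly fixed UNIT `f·Q^k` is a Θ-norm (`hFN`, ★ p857943). [cite: Serre1979, Ch. V §3 Cor. 3] -/
theorem exists_norm_eq_of_fixed_fixed (hρρ : ∀ x, ρ (ρ x) = x) (hΘΘ : ∀ x, Θ (Θ x) = x) (hΘρ : ∀ x, Θ (ρ x) = ρ (Θ x))
    (hvρ : ∀ x, Valued.v (ρ x) = Valued.v x) (hvΘ : ∀ x, Valued.v (Θ x) = Valued.v x)
    (hF4 : ∀ f : K, ρ f = f → Θ f = f → f ≠ 0 → ∃ n : ℤ, Valued.v f = exp (4 * n))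
    (hFN : ∀ f : K, ρ f = f → Θ f = f → Valued.v f = 1 → ∃ x : K, x * Θ x = f)
    {ϖM : K} (hϖM : Valued.v ϖM = exp (-1 : ℤ)) {f : K} (hρf : ρ f = f) (hΘf : Θ f = f) (hf0 : f ≠ 0) :
    ∃ w : K, w * Θ w = f := by
  have hϖ0 : ϖM ≠ 0 := fun h0 => by rw [h0, map_zero] at hϖM; exact (exp_ne_zero hϖM.symm).elim
  obtain ⟨n, hn⟩ := hF4 f hρf hΘf hf0
  -- `Q := N_Θ(ϖM·ρϖM)`, doubly fixed of valuation `exp(−4)`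
  have hρa : ρ (ϖM * ρ ϖM) = ϖM * ρ ϖM := by rw [map_mul, hρρ, mul_comm]
  have hρQ : ρ ((ϖM * ρ ϖM) * Θ (ϖM * ρ ϖM)) = (ϖM * ρ ϖM) * Θ (ϖM * ρ ϖM) := by rw [map_mul, ← hΘρ, hρa]
  have hΘQ : Θ ((ϖM * ρ ϖM) * Θ (ϖM * ρ ϖM)) = (ϖM * ρ ϖM) * Θ (ϖM * ρ ϖM) := by rw [map_mul, hΘΘ, mul_comm]
  have hvQ : Valued.v ((ϖM * ρ ϖM) * Θ (ϖM * ρ ϖM)) = exp (-4 : ℤ) := by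
    rw [Valuation.map_mul, hvΘ, Valuation.map_mul, hvρ, hϖM, ← exp_add, ← exp_add]; rfl
  have hQ0 : (ϖM * ρ ϖM) * Θ (ϖM * ρ ϖM) ≠ 0 := fun h0 => by rw [h0, map_zero] at hvQ; exact (exp_ne_zero hvQ.symm).elim
  -- the unit `f·Q^n`
  have hu1 : Valued.v (f * ((ϖM * ρ ϖM) * Θ (ϖM * ρ ϖM)) ^ n) = 1 := by
    rw [Valuation.map_mul, map_zpow₀, hn, hvQ, ← exp_zsmul, ← exp_add, ← exp_zero]
    congr 1; simp only [smul_eq_mul]; ring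
  obtain ⟨z, hz⟩ := hFN _ (by rw [map_mul, map_zpow₀, hρf, hρQ]) (by rw [map_mul, map_zpow₀, hΘf, hΘQ]) hu1
  refine ⟨z * (ϖM * ρ ϖM) ^ (-n), ?_⟩
  have h1 : z * (ϖM * ρ ϖM) ^ (-n) * Θ (z * (ϖM * ρ ϖM) ^ (-n)) = (z * Θ z) * ((ϖM * ρ ϖM) * Θ (ϖM * ρ ϖM)) ^ (-n) := by
    rw [map_mul, map_zpow₀, mul_zpow (ϖM * ρ ϖM) (Θ (ϖM * ρ ϖM))]; ring
  rw [h1, hz, zpow_neg, mul_assoc, mul_inv_cancel₀ (zpow_ne_zero n hQ0), mul_one]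

/-- **THE FAR-CELL CLASS CRITERION, CLASS T ⇒ `y ∈ F^×·N_Θ(U_M)`.**  Frame: `ρ, Θ` commuting isometric involutions, `hF4`, the third-field package `(K′, σ′, π′, d′, jK)`
(`jK ∘ σ′ = ρ ∘ jK`, `|jKπ′| = exp(−2)`, `|π′ − σ′π′| = |π′|^{d′}`), the Θ-datum `(ϖ, dΘ, tΘ)` on a complete `M` with finite residue field, `hFN`, and the Θ-fixed unit non-norm
`n₀`.  If a Θ-fixed `y ≠ 0` is in CLASS T at the far radius `R″ = |jK π′^{d′ + (dΘ − 1)}|` — `∃ ω ∈ U_M, |ψ(y)·t(ω) − 1| ≤ R″` — then `y = f·N_Θ(x)` with `f` doubly fixed and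
`x` a unit.  [cite: Serre1979, Ch. V §3 Prop. 5 and Cor. 3] [cite: Jacobowitz1962, §4] [cite: Rogawski1990, §4.9 Prop. 4.9.1 (b) p. 55] -/
theorem exists_fixed_mul_norm_of_twistNear_far [CompleteSpace K] [Finite 𝓀[K]]
    (hρρ : ∀ x, ρ (ρ x) = x) (hvρ : ∀ x, Valued.v (ρ x) = Valued.v x) (hΘρ : ∀ x, Θ (ρ x) = ρ (Θ x)) (hvΘ : ∀ x, Valued.v (Θ x) = Valued.v x)
    (hF4 : ∀ f : K, ρ f = f → Θ f = f → f ≠ 0 → ∃ n : ℤ, Valued.v f = exp (4 * n))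
    (hσ' : ∀ x, σ' (σ' x) = x) (hvσ' : ∀ x, Valued.v (σ' x) = Valued.v x) (hfix' : ∀ x : K', σ' x = x → x ≠ 0 → ∃ n : ℤ, Valued.v x = exp (2 * n))
    (hπ' : Valued.v π' = exp (-1 : ℤ)) (hdd' : Valued.v (π' - σ' π') = Valued.v π' ^ d')
    (jK : K' →+* K) (hjle : ∀ x y : K', Valued.v (jK x) ≤ Valued.v (jK y) ↔ Valued.v x ≤ Valued.v y) (hjΘ : ∀ x, Θ (jK x) = jK x)
    (hjfix : ∀ z : K, Θ z = z → ∃ x, jK x = z) (hjσ : ∀ x, jK (σ' x) = ρ (jK x)) (hjπ : Valued.v (jK π') = exp (-2 : ℤ))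
    {ϖ : K} {dΘ tΘ : ℕ} (hDΘ : IsRamifiedQuadraticDatum Θ ϖ dΘ tΘ)
    (hFN : ∀ f : K, ρ f = f → Θ f = f → Valued.v f = 1 → ∃ x : K, x * Θ x = f)
    {n₀ : K} (hΘn₀ : Θ n₀ = n₀) (hn₀1 : Valued.v n₀ = 1) (hn₀N : ¬ ∃ z : K, z * Θ z = n₀)
    {y : K} (hΘy : Θ y = y) (hy0 : y ≠ 0)
    (hT : ∃ ω : K, Valued.v ω = 1 ∧ Valued.v (ρ y / y * (ρ (ω * Θ ω) / (ω * Θ ω)) - 1) ≤ Valued.v (jK π' ^ (d' + (dΘ - 1)))) :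
    ∃ f x : K, ρ f = f ∧ Θ f = f ∧ f ≠ 0 ∧ Valued.v x = 1 ∧ y = f * (x * Θ x) := by
  obtain ⟨hΘΘ, -, -, hevΘ, -, hdΘ1, -⟩ := id hDΘ
  obtain ⟨ω, hω, hle⟩ := hT
  have hω0 : ω ≠ 0 := fun h0 => by rw [h0, map_zero] at hω; exact zero_ne_one hω
  have hN0 : ω * Θ ω ≠ 0 := mul_ne_zero hω0 ((map_ne_zero Θ).2 hω0)
  have hΘN : Θ (ω * Θ ω) = ω * Θ ω := by rw [map_mul, hΘΘ, mul_comm]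
  have hvN : Valued.v (ω * Θ ω) = 1 := by rw [Valuation.map_mul, hvΘ, hω, mul_one]
  -- the letters of the package: `P := jKπ′`, `ξ₁ := P − ρP`
  have hdP := v_thirdFieldUniformizer_sub_map hdd' jK hjle hjσ hjπ
  -- the radius `R″ = exp(−2d′ − 2dΘ + 2)`
  have hR : Valued.v (jK π' ^ (d' + (dΘ - 1))) = exp (-(2 * (d' : ℤ)) - 2 * dΘ + 2) := by
    rw [map_pow, hjπ, ← exp_nsmul, nsmul_eq_mul]; congr 1; push_cast; omega
  -- `c := y·N(ω)` is Θ-fixed with `|ψ(c) − 1| ≤ R″`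
  set c : K := y * (ω * Θ ω) with hc
  have hc0 : c ≠ 0 := mul_ne_zero hy0 hN0
  have hΘc : Θ c = c := by rw [hc, map_mul, hΘy, hΘN]
  have hψc : Valued.v (ρ c / c - 1) ≤ Valued.v (jK π' ^ (d' + (dΘ - 1))) := by
    rw [hc, ← div_mul_div_eq_map_mul_div ρ hy0 hN0]; exact hle
  -- ### `ord_M c ∈ 4ℤ`: the odd shell is outside `R″`
  obtain ⟨n, hn⟩ := hevΘ c hΘc hc0
  obtain ⟨n', hn'⟩ : ∃ n' : ℤ, n = 2 * n' := by
    rcases Int.even_or_odd' n with ⟨k, hk | hk⟩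
    · exact ⟨k, hk⟩
    · exfalso
      have hvc : Valued.v c = exp (4 * k + 2) := by rw [hn, hk]; congr 1; ring
      have h1 := v_map_div_sub_one_eq_of_odd hρρ hΘρ hF4 (hjΘ π') hjπ hdP hΘc hvc
      rw [h1, hR, exp_le_exp] at hψc
      omega
  -- ### unitise by the doubly fixed `Q := N_Θ(ϖM·ρϖM)`, `ϖM := ` any uniformiser: use `ϖ` of the Θ-datum
  have hϖv : Valued.v ϖ = exp (-1 : ℤ) := hDΘ.2.2.1
  have hϖ0 : ϖ ≠ 0 := fun h0 => by rw [h0, map_zero] at hϖv; exact (exp_ne_zero hϖv.symm).elim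
  have hρa : ρ (ϖ * ρ ϖ) = ϖ * ρ ϖ := by rw [map_mul, hρρ, mul_comm]
  have hρQ : ρ ((ϖ * ρ ϖ) * Θ (ϖ * ρ ϖ)) = (ϖ * ρ ϖ) * Θ (ϖ * ρ ϖ) := by rw [map_mul, ← hΘρ, hρa]
  have hΘQ : Θ ((ϖ * ρ ϖ) * Θ (ϖ * ρ ϖ)) = (ϖ * ρ ϖ) * Θ (ϖ * ρ ϖ) := by rw [map_mul, hΘΘ, mul_comm]
  have hvQ : Valued.v ((ϖ * ρ ϖ) * Θ (ϖ * ρ ϖ)) = exp (-4 : ℤ) := by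
    rw [Valuation.map_mul, hvΘ, Valuation.map_mul, hvρ, hϖv, ← exp_add, ← exp_add]; rfl
  have hQ0 : (ϖ * ρ ϖ) * Θ (ϖ * ρ ϖ) ≠ 0 := fun h0 => by rw [h0, map_zero] at hvQ; exact (exp_ne_zero hvQ.symm).elim
  set Q : K := (ϖ * ρ ϖ) * Θ (ϖ * ρ ϖ) with hQ
  set u : K := c * Q ^ n' with hu
  have hu1 : Valued.v u = 1 := by
    rw [hu, Valuation.map_mul, map_zpow₀, hn, hn', hvQ, ← exp_zsmul, ← exp_add, ← exp_zero]
    congr 1; simp only [smul_eq_mul]; ring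
  have hu0 : u ≠ 0 := fun h0 => by rw [h0, map_zero] at hu1; exact zero_ne_one hu1
  have hΘu : Θ u = u := by rw [hu, map_mul, map_zpow₀, hΘc, hΘQ]
  have hψu : ρ u / u = ρ c / c := by
    rw [hu, map_mul, map_zpow₀, hρQ, mul_div_mul_right _ _ (zpow_ne_zero n' hQ0)]
  -- ### the dichotomy `K♮ˣ = N ⊔ c₀N` against the threshold
  obtain ⟨c₀, -, hc₀N, hdich⟩ := exists_nonnorm_dichotomy hDΘ
  have hn₀0 : n₀ ≠ 0 := fun h0 => by rw [h0, map_zero] at hn₀1; exact zero_ne_one hn₀1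
  rcases hdich u hΘu hu0 with ⟨ω₁, hω₁⟩ | ⟨ω₁, hω₁⟩
  · -- `u = N(ω₁)`: `y = Q^{−n′}·N(ω₁∕ω)`
    have hω₁1 : Valued.v ω₁ = 1 := v_eq_one_of_v_mul_map_eq_one hvΘ (by rw [hω₁, hu1])
    refine ⟨Q ^ (-n'), ω₁ / ω, by rw [map_zpow₀, hρQ], by rw [map_zpow₀, hΘQ], zpow_ne_zero _ hQ0,
      by rw [map_div₀, hω₁1, hω, div_one], ?_⟩
    have hΘω0 : Θ ω ≠ 0 := (map_ne_zero Θ).2 hω0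
    have h1 : ω₁ / ω * Θ (ω₁ / ω) = u / (ω * Θ ω) := by rw [map_div₀, div_mul_div_comm, hω₁]
    rw [h1, hu, hc, zpow_neg]
    field_simp
  · -- `c₀·u = N(ω₁)`: then `u ∈ n₀·N(U)` and `ψ(n₀)·t` meets `R″` — the threshold says no
    exfalso
    have hc₀0 : c₀ ≠ 0 := fun h0 => hc₀N ⟨0, by rw [h0, zero_mul]⟩
    obtain ⟨ω₂, hω₂⟩ : ∃ z : K, z * Θ z = c₀ * n₀ := (hdich n₀ hΘn₀ hn₀0).resolve_left hn₀N
    have hω₂0 : ω₂ ≠ 0 := fun h0 => by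
      rw [h0, zero_mul] at hω₂; exact mul_ne_zero hc₀0 hn₀0 hω₂.symm
    have hNω : ω₁ / ω₂ * Θ (ω₁ / ω₂) = u / n₀ := by
      rw [map_div₀, div_mul_div_comm, hω₁, hω₂, mul_div_mul_left _ _ hc₀0]
    have hω12 : Valued.v (ω₁ / ω₂) = 1 := v_eq_one_of_v_mul_map_eq_one hvΘ (by rw [hNω, map_div₀, hu1, hn₀1, div_one])
    have hN12 : ω₁ / ω₂ * Θ (ω₁ / ω₂) ≠ 0 := by rw [hNω]; exact div_ne_zero hu0 hn₀0
    have hkey : ρ n₀ / n₀ * (ρ (ω₁ / ω₂ * Θ (ω₁ / ω₂)) / (ω₁ / ω₂ * Θ (ω₁ / ω₂))) = ρ c / c := by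
      rw [div_mul_div_eq_map_mul_div ρ hn₀0 hN12, hNω, mul_div_cancel₀ _ hn₀0, hψu]
    have hthr := (anchored_twist_near_iff_lt_threshold hvΘ hσ' hvσ' hfix' hπ' hdd' jK hjle hjΘ hjfix hjσ hjπ hDΘ hFN hΘn₀ hn₀1 hn₀N (dΘ - 1)).1
      ⟨ω₁ / ω₂, hω12, by rw [hkey]; exact hψc⟩
    omega

/-- **CLASS E ⇒ `y ∈ F^×·n₀·N_Θ(U_M)`** (class T for `y·n₀`). [cite: Serre1979, Ch. V §3 Prop. 5 and Cor. 3] [cite: Jacobowitz1962, §4] -/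
theorem exists_fixed_mul_anchored_of_anchoredNear_far [CompleteSpace K] [Finite 𝓀[K]]
    (hρρ : ∀ x, ρ (ρ x) = x) (hvρ : ∀ x, Valued.v (ρ x) = Valued.v x) (hΘρ : ∀ x, Θ (ρ x) = ρ (Θ x)) (hvΘ : ∀ x, Valued.v (Θ x) = Valued.v x)
    (hF4 : ∀ f : K, ρ f = f → Θ f = f → f ≠ 0 → ∃ n : ℤ, Valued.v f = exp (4 * n))
    (hσ' : ∀ x, σ' (σ' x) = x) (hvσ' : ∀ x, Valued.v (σ' x) = Valued.v x) (hfix' : ∀ x : K', σ' x = x → x ≠ 0 → ∃ n : ℤ, Valued.v x = exp (2 * n))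
    (hπ' : Valued.v π' = exp (-1 : ℤ)) (hdd' : Valued.v (π' - σ' π') = Valued.v π' ^ d')
    (jK : K' →+* K) (hjle : ∀ x y : K', Valued.v (jK x) ≤ Valued.v (jK y) ↔ Valued.v x ≤ Valued.v y) (hjΘ : ∀ x, Θ (jK x) = jK x)
    (hjfix : ∀ z : K, Θ z = z → ∃ x, jK x = z) (hjσ : ∀ x, jK (σ' x) = ρ (jK x)) (hjπ : Valued.v (jK π') = exp (-2 : ℤ))
    {ϖ : K} {dΘ tΘ : ℕ} (hDΘ : IsRamifiedQuadraticDatum Θ ϖ dΘ tΘ)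
    (hFN : ∀ f : K, ρ f = f → Θ f = f → Valued.v f = 1 → ∃ x : K, x * Θ x = f)
    {n₀ : K} (hΘn₀ : Θ n₀ = n₀) (hn₀1 : Valued.v n₀ = 1) (hn₀N : ¬ ∃ z : K, z * Θ z = n₀)
    {y : K} (hΘy : Θ y = y) (hy0 : y ≠ 0)
    (hE : ∃ ω : K, Valued.v ω = 1 ∧ Valued.v (ρ y / y * (ρ n₀ / n₀) * (ρ (ω * Θ ω) / (ω * Θ ω)) - 1) ≤ Valued.v (jK π' ^ (d' + (dΘ - 1)))) :
    ∃ f x : K, ρ f = f ∧ Θ f = f ∧ f ≠ 0 ∧ Valued.v x = 1 ∧ y = f * n₀ * (x * Θ x) := by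
  have hΘΘ := hDΘ.1
  have hn₀0 : n₀ ≠ 0 := fun h0 => by rw [h0, map_zero] at hn₀1; exact zero_ne_one hn₀1
  -- class E for `y` is class T for `y·n₀`
  have hΘyn : Θ (y * n₀) = y * n₀ := by rw [map_mul, hΘy, hΘn₀]
  have hT : ∃ ω : K, Valued.v ω = 1 ∧ Valued.v (ρ (y * n₀) / (y * n₀) * (ρ (ω * Θ ω) / (ω * Θ ω)) - 1) ≤ Valued.v (jK π' ^ (d' + (dΘ - 1))) := by
    obtain ⟨ω, hω, h⟩ := hE
    exact ⟨ω, hω, by rw [← div_mul_div_eq_map_mul_div ρ hy0 hn₀0]; exact h⟩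
  obtain ⟨f, x, hρf, hΘf, hf0, hx1, hyx⟩ := exists_fixed_mul_norm_of_twistNear_far hρρ hvρ hΘρ hvΘ hF4 hσ' hvσ' hfix' hπ' hdd' jK hjle hjΘ hjfix hjσ hjπ
    hDΘ hFN hΘn₀ hn₀1 hn₀N hΘyn (mul_ne_zero hy0 hn₀0) hT
  refine ⟨f, x / n₀, hρf, hΘf, hf0, by rw [map_div₀, hx1, hn₀1, div_one], ?_⟩
  rw [map_div₀, hΘn₀, show f * n₀ * (x / n₀ * (Θ x / n₀)) = f * (x * Θ x) / n₀ by field_simp, ← hyx, mul_div_cancel_right₀ _ hn₀0]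

omit [Valued K ℤᵐ⁰] in
/-- **`y ∈ F^×·N_Θ(M^×)` ⇒ `N_{K♮∕F}(y) = y·ρy` IS AN `E ∕ F`-NORM**: `y = f·(z·Θz)` with `f` doubly fixed gives `e := f·z·ρz`, `ρe = e`, `e·Θe = y·ρy`.
[cite: Serre1979, Ch. V §3 Cor. 3] -/
theorem exists_rhoNorm_of_eq_fixed_mul_norm (hρρ : ∀ x, ρ (ρ x) = x) (hΘρ : ∀ x, Θ (ρ x) = ρ (Θ x))
    {f z y : K} (hρf : ρ f = f) (hΘf : Θ f = f) (hy : y = f * (z * Θ z)) : ∃ e : K, ρ e = e ∧ e * Θ e = y * ρ y :=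
  ⟨f * (z * ρ z), by rw [map_mul, map_mul, hρf, hρρ, mul_comm (ρ z)], by rw [hy, map_mul, map_mul, map_mul, map_mul, hΘf, hρf, ← hΘρ]; ring⟩

/-- **`y ∈ F^×·n₀·N_Θ(M^×)` ⇒ `N_{K♮∕F}(y)` IS NOT AN `E ∕ F`-NORM** — through Σ1 ★ p858275 (`side_iff_exists_norm_ramM`, its `hf` = Σ2 ★ p858318): an `E ∕ F`-norm `y·ρy` would put
`y` in `N_Θ(U_M)·N_Θ(ϖ)^ℤ`, and with `y = f·n₀·N_Θ(x)`, `f = N_Θ(w)` (`exists_norm_eq_of_fixed_fixed`) the non-norm `n₀` would be a Θ-norm.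
[cite: Serre1979, Ch. V §3 Cor. 3] [cite: Rogawski1990, §4.9 Prop. 4.9.1 (b) p. 55] -/
theorem not_exists_rhoNorm_of_eq_fixed_mul_anchored
    (hρρ : ∀ x, ρ (ρ x) = x) (hΘΘ : ∀ x, Θ (Θ x) = x) (hΘρ : ∀ x, Θ (ρ x) = ρ (Θ x))
    (hvρ : ∀ x, Valued.v (ρ x) = Valued.v x) (hvΘ : ∀ x, Valued.v (Θ x) = Valued.v x)
    (hF4 : ∀ f : K, ρ f = f → Θ f = f → f ≠ 0 → ∃ n : ℤ, Valued.v f = exp (4 * n))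
    (hFN : ∀ f : K, ρ f = f → Θ f = f → Valued.v f = 1 → ∃ x : K, x * Θ x = f)
    (hevΘ : ∀ z : K, Θ z = z → z ≠ 0 → ∃ n : ℤ, Valued.v z = exp (2 * n))
    {n₀ : K} (hΘn₀ : Θ n₀ = n₀) (hn₀N : ¬ ∃ z : K, z * Θ z = n₀)
    {c₀ : K} (hc₀ : Valued.v c₀ = 1) (hdich : ∀ u : K, Θ u = u → Valued.v u = 1 → (∃ z : K, z * Θ z = u) ∨ ∃ z : K, z * Θ z = c₀ * u)
    (hf : ∃ a : K, Θ a = a ∧ Valued.v a = 1 ∧ ¬ ∃ e : K, ρ e = e ∧ e * Θ e = a * ρ a)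
    {ϖ : K} (hϖv : Valued.v ϖ = exp (-1 : ℤ))
    {f x y : K} (hρf : ρ f = f) (hΘf : Θ f = f) (hf0 : f ≠ 0) (hx0 : x ≠ 0) (hy0 : y ≠ 0) (hyx : y = f * n₀ * (x * Θ x)) :
    ¬ ∃ e : K, ρ e = e ∧ e * Θ e = y * ρ y := by
  have hϖ0 : ϖ ≠ 0 := fun h0 => by rw [h0, map_zero] at hϖv; exact (exp_ne_zero hϖv.symm).elim
  have hΘy : Θ y = y := by rw [hyx, map_mul, map_mul, map_mul, hΘf, hΘn₀, hΘΘ, mul_comm (Θ x) x]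
  obtain ⟨n, hn⟩ := hevΘ y hΘy hy0
  intro hnorm
  -- Σ1: `y ∈ N_Θ(U_M)·N_Θ(ϖ)^ℤ`
  obtain ⟨x', j, -, hx'⟩ := (side_iff_exists_norm_ramM hΘΘ hvΘ hΘρ hρρ hc₀ hdich hf hϖv hΘy hn).2 hnorm
  -- `f = N_Θ(w)`
  obtain ⟨w, hw⟩ := exists_norm_eq_of_fixed_fixed hρρ hΘΘ hΘρ hvρ hvΘ hF4 hFN hϖv hρf hΘf hf0
  have hw0 : w ≠ 0 := fun h0 => hf0 (by rw [← hw, h0, zero_mul])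
  -- then `n₀` is a Θ-norm
  apply hn₀N
  refine ⟨x' * ϖ ^ (-j) / (w * x), ?_⟩
  have hΘϖ0 : Θ ϖ ≠ 0 := (map_ne_zero Θ).2 hϖ0
  have hNϖ0 : ϖ * Θ ϖ ≠ 0 := mul_ne_zero hϖ0 hΘϖ0
  have hΘw0 : Θ w ≠ 0 := (map_ne_zero Θ).2 hw0
  have hΘx0 : Θ x ≠ 0 := (map_ne_zero Θ).2 hx0
  have hNx0 : x * Θ x ≠ 0 := mul_ne_zero hx0 hΘx0
  have h1 : x' * Θ x' = f * n₀ * (x * Θ x) * (ϖ * Θ ϖ) ^ j := by rw [hx', hyx]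
  have e1 : x' * ϖ ^ (-j) / (w * x) * Θ (x' * ϖ ^ (-j) / (w * x)) = (x' * Θ x') * (ϖ * Θ ϖ) ^ (-j) / ((w * Θ w) * (x * Θ x)) := by
    rw [map_div₀, map_mul, map_mul, map_zpow₀, mul_zpow ϖ (Θ ϖ)]
    field_simp
  rw [e1, h1, hw, show f * n₀ * (x * Θ x) * (ϖ * Θ ϖ) ^ j * (ϖ * Θ ϖ) ^ (-j) = n₀ * (f * (x * Θ x)) * ((ϖ * Θ ϖ) ^ j * (ϖ * Θ ϖ) ^ (-j)) by ring,
    ← zpow_add₀ hNϖ0, add_neg_cancel, zpow_zero, mul_one, mul_div_assoc, div_self (mul_ne_zero hf0 hNx0), mul_one]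

/-- **CLASS T AT THE FAR CELL ⇒ `N_{K♮∕F}(y)` IS AN `E ∕ F`-NORM**: `∃ e, ρe = e ∧ e·Θe = y·ρy` (`y = f·N_Θ(x)` gives `e := f·x·ρx`).
[cite: Serre1979, Ch. V §3 Cor. 3] [cite: Rogawski1990, §4.9 Prop. 4.9.1 (b) p. 55] -/
theorem exists_rhoNorm_of_twistNear_far [CompleteSpace K] [Finite 𝓀[K]]
    (hρρ : ∀ x, ρ (ρ x) = x) (hvρ : ∀ x, Valued.v (ρ x) = Valued.v x) (hΘρ : ∀ x, Θ (ρ x) = ρ (Θ x)) (hvΘ : ∀ x, Valued.v (Θ x) = Valued.v x)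
    (hF4 : ∀ f : K, ρ f = f → Θ f = f → f ≠ 0 → ∃ n : ℤ, Valued.v f = exp (4 * n))
    (hσ' : ∀ x, σ' (σ' x) = x) (hvσ' : ∀ x, Valued.v (σ' x) = Valued.v x) (hfix' : ∀ x : K', σ' x = x → x ≠ 0 → ∃ n : ℤ, Valued.v x = exp (2 * n))
    (hπ' : Valued.v π' = exp (-1 : ℤ)) (hdd' : Valued.v (π' - σ' π') = Valued.v π' ^ d')
    (jK : K' →+* K) (hjle : ∀ x y : K', Valued.v (jK x) ≤ Valued.v (jK y) ↔ Valued.v x ≤ Valued.v y) (hjΘ : ∀ x, Θ (jK x) = jK x)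
    (hjfix : ∀ z : K, Θ z = z → ∃ x, jK x = z) (hjσ : ∀ x, jK (σ' x) = ρ (jK x)) (hjπ : Valued.v (jK π') = exp (-2 : ℤ))
    {ϖ : K} {dΘ tΘ : ℕ} (hDΘ : IsRamifiedQuadraticDatum Θ ϖ dΘ tΘ)
    (hFN : ∀ f : K, ρ f = f → Θ f = f → Valued.v f = 1 → ∃ x : K, x * Θ x = f)
    {n₀ : K} (hΘn₀ : Θ n₀ = n₀) (hn₀1 : Valued.v n₀ = 1) (hn₀N : ¬ ∃ z : K, z * Θ z = n₀)
    {y : K} (hΘy : Θ y = y) (hy0 : y ≠ 0)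
    (hT : ∃ ω : K, Valued.v ω = 1 ∧ Valued.v (ρ y / y * (ρ (ω * Θ ω) / (ω * Θ ω)) - 1) ≤ Valued.v (jK π' ^ (d' + (dΘ - 1)))) :
    ∃ e : K, ρ e = e ∧ e * Θ e = y * ρ y := by
  obtain ⟨f, x, hρf, hΘf, -, -, hyx⟩ := exists_fixed_mul_norm_of_twistNear_far hρρ hvρ hΘρ hvΘ hF4 hσ' hvσ' hfix' hπ' hdd' jK hjle hjΘ hjfix hjσ hjπ
    hDΘ hFN hΘn₀ hn₀1 hn₀N hΘy hy0 hT
  exact exists_rhoNorm_of_eq_fixed_mul_norm hρρ hΘρ hρf hΘf hyx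

/-- **CLASS E AT THE FAR CELL ⇒ `N_{K♮∕F}(y)` IS NOT AN `E ∕ F`-NORM** — through Σ1 ★ p858275 (`side_iff_exists_norm_ramM`, its `hf` = Σ2 ★ p858318): an `E ∕ F`-norm
`y·ρy` would put `y` in `N_Θ(U_M)·N_Θ(ϖM)^ℤ`, and with `y = f·n₀·N_Θ(x)`, `f = N_Θ(w)` (★ `exists_norm_eq_of_fixed_fixed`) the non-norm `n₀` would be a Θ-norm.
[cite: Serre1979, Ch. V §3 Cor. 3] [cite: Rogawski1990, §4.9 Prop. 4.9.1 (b) p. 55] -/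
theorem not_exists_rhoNorm_of_anchoredNear_far [CompleteSpace K] [Finite 𝓀[K]]
    (hρρ : ∀ x, ρ (ρ x) = x) (hvρ : ∀ x, Valued.v (ρ x) = Valued.v x) (hΘρ : ∀ x, Θ (ρ x) = ρ (Θ x)) (hvΘ : ∀ x, Valued.v (Θ x) = Valued.v x)
    (hF4 : ∀ f : K, ρ f = f → Θ f = f → f ≠ 0 → ∃ n : ℤ, Valued.v f = exp (4 * n))
    (hσ' : ∀ x, σ' (σ' x) = x) (hvσ' : ∀ x, Valued.v (σ' x) = Valued.v x) (hfix' : ∀ x : K', σ' x = x → x ≠ 0 → ∃ n : ℤ, Valued.v x = exp (2 * n))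
    (hπ' : Valued.v π' = exp (-1 : ℤ)) (hdd' : Valued.v (π' - σ' π') = Valued.v π' ^ d')
    (jK : K' →+* K) (hjle : ∀ x y : K', Valued.v (jK x) ≤ Valued.v (jK y) ↔ Valued.v x ≤ Valued.v y) (hjΘ : ∀ x, Θ (jK x) = jK x)
    (hjfix : ∀ z : K, Θ z = z → ∃ x, jK x = z) (hjσ : ∀ x, jK (σ' x) = ρ (jK x)) (hjπ : Valued.v (jK π') = exp (-2 : ℤ))
    {ϖ : K} {dΘ tΘ : ℕ} (hDΘ : IsRamifiedQuadraticDatum Θ ϖ dΘ tΘ)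
    (hFN : ∀ f : K, ρ f = f → Θ f = f → Valued.v f = 1 → ∃ x : K, x * Θ x = f)
    {n₀ : K} (hΘn₀ : Θ n₀ = n₀) (hn₀1 : Valued.v n₀ = 1) (hn₀N : ¬ ∃ z : K, z * Θ z = n₀)
    -- the Σ1 letters: the Θ unit-norm dichotomy and the letter `hf` (★ Σ2)
    {c₀ : K} (hc₀ : Valued.v c₀ = 1) (hdich : ∀ u : K, Θ u = u → Valued.v u = 1 → (∃ z : K, z * Θ z = u) ∨ ∃ z : K, z * Θ z = c₀ * u)
    (hf : ∃ a : K, Θ a = a ∧ Valued.v a = 1 ∧ ¬ ∃ e : K, ρ e = e ∧ e * Θ e = a * ρ a)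
    {y : K} (hΘy : Θ y = y) (hy0 : y ≠ 0)
    (hE : ∃ ω : K, Valued.v ω = 1 ∧ Valued.v (ρ y / y * (ρ n₀ / n₀) * (ρ (ω * Θ ω) / (ω * Θ ω)) - 1) ≤ Valued.v (jK π' ^ (d' + (dΘ - 1)))) :
    ¬ ∃ e : K, ρ e = e ∧ e * Θ e = y * ρ y := by
  obtain ⟨hΘΘ, -, hϖv, hevΘ, -, -, -⟩ := id hDΘ
  obtain ⟨f, x, hρf, hΘf, hf0, hx1, hyx⟩ := exists_fixed_mul_anchored_of_anchoredNear_far hρρ hvρ hΘρ hvΘ hF4 hσ' hvσ' hfix' hπ' hdd' jK hjle hjΘ hjfix hjσ hjπ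
    hDΘ hFN hΘn₀ hn₀1 hn₀N hΘy hy0 hE
  have hx0 : x ≠ 0 := fun h0 => by rw [h0, map_zero] at hx1; exact zero_ne_one hx1
  exact not_exists_rhoNorm_of_eq_fixed_mul_anchored hρρ hΘΘ hΘρ hvρ hvΘ hF4 hFN hevΘ hΘn₀ hn₀N hc₀ hdich hf hϖv hρf hΘf hf0 hx0 hy0 hyx

/-! ## §4 The radius dictionary -/

omit [Valued K' ℤᵐ⁰] in
/-- `|jK π′^{d′ + (dΘ − 1)}| = exp(−(2(s0 + 2g − 1) + d_ρ))` under `dΘ = 2g`, `2d′ = d_ρ + 2s0`, `1 ≤ g`. [cite: Serre1979, Ch. V §3 Prop. 5] -/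
theorem v_jK_pow_far_eq (jK : K' →+* K) (hjπ : Valued.v (jK π') = exp (-2 : ℤ)) {dΘ dρ g s0 : ℕ}
    (hg : dΘ = 2 * g) (hds : 2 * d' = dρ + 2 * s0) (hg1 : 1 ≤ g) :
    Valued.v (jK π' ^ (d' + (dΘ - 1))) = exp (-(2 * ((s0 : ℤ) + 2 * g - 1) + dρ)) := by
  rw [map_pow, hjπ, ← exp_nsmul, nsmul_eq_mul]
  congr 1
  push_cast
  omega

end Summit.HodgeConjecture.HodgeConjecture.Cruxes.H413.F0P3cDyRamSignFarCellRamM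

end
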